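import Mathlib.Analysis.Complex.Basic
import Mathlib.Analysis.SpecialFunctions.Pow.Real
import Mathlib.Analysis.Real.Pi.Bounds
import Mathlib.Tactic
import Literature.NumberTheory.LFunctions.SemimultiplicativeMoebiusCircle
import HarnessLib

/-!
# Imaginary-axis stability of the cell's explicit Runge–Kutta steppers, and the advective CFL numbers it allows

HONEST FRAMING (cell `pub-fluidc`, verbatim): *low prior, high value-of-information experiment on Tao's machine
paradigm; NOT a claim that NS blows up.* Nothing here is about the Navier–Stokes PDE. The cell's forward engines step
the Galerkin system (`GalerkinEnergyBalance`, `VorticityForm`) with EXPLICIT Runge–Kutta methods — dns-A and p1spec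
with the classical four-stage RK4, dns-B with the Shu–Osher SSP-RK3 (on the integrating-factor variable) — under the
advective step rule `Δt = cfl · h / max_x (|u|+|v|+|w|)` (HOME/paper/sec-dnsB.md §B.2; sec-p1spec.md §P.2). This file
records, with proofs, the textbook facts behind the `cfl` values quoted there:

* `rk4Step_linear`, `ssprk3Step_linear` — applied to the scalar test equation `u' = λ u`, one classical RK4 step
  (resp. one Shu–Osher SSP-RK3 step) multiplies `u` by the STABILITY POLYNOMIAL `R₄(λΔt) = Σ_{j≤4} (λΔt)^j/j!`
  (resp. `R₃ = Σ_{j≤3}`) [cite: CanutoEtAl2006, App. D §D.2.5 (D.2.16)–(D.2.17)]; "All Runge–Kutta methods of a given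
  order have the same stability properties" (ibid.; for the explicit methods here the order equals the number of
  stages, `s = p ≤ 4`), in particular the Shu–Osher SSP-RK3 = SSPRK(3,3)
  [cite: GottliebKetchesonShu2011, §2.4.2 Thm. 2.3] (introduced in [cite: ShuOsher1988, §2]) shares `R₃`;
* `normSq_R4_imag`, `normSq_R3_imag` — on the imaginary axis `|R₄(iy)|² = 1 − y⁶/72 + y⁸/576` and
  `|R₃(iy)|² = 1 − y⁴/12 + y⁶/36`;
* `norm_R4_imag_le_one_iff`, `norm_R3_imag_le_one_iff` — hence `|R₄(iy)| ≤ 1 ⟺ y² ≤ 8` (`|y| ≤ 2√2 = 2.83`) and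
  `|R₃(iy)| ≤ 1 ⟺ y² ≤ 3` (`|y| ≤ √3 = 1.73`): the imaginary-axis stability intervals of Table D.1
  [cite: CanutoEtAl2006, App. D Table D.1 (RK3 [0, 1.73], RK4 [0, 2.83])];
* the CFL reading (`advective_symbol_le`, `symbol_dt_le`, `rk4_cfl_window`, `rk3_cfl_window`): for a frozen velocity
  `U` and a retained mode `k` with `|k_i| · h ≤ κ`, the advective symbol `λ = −i U·k` has `|λ| Δt ≤ cfl · κ` under the
  step rule. On the cubic 2/3 truncation `κ = 2π/3` works for EVERY `N` (`|j_i| < N/3`, `k_i = 2πj_i/L`, `h = L/N`), and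
  then the spectrum lies in RK4's interval whenever `cfl ≤ 1.35` and in RK3's whenever `cfl ≤ 0.826` (thresholds
  `3√2/π = 1.3505…`, `3√3/(2π) = 0.82699…`); with the lattice's own `κ = 2π · 85/256` (`k_max = 85` at `N = 256`, `170` at
  `512`) the RK3 threshold is `0.8302`, which is §B.2's printed `cfl ≤ 0.83` (`rk3_cfl_window_kmax85`). The production
  value `cfl = 0.75` of both engines is inside both windows (RK4 by a factor `1.8`, RK3 by `1.10`;
  `production_cfl_inside`).

What this is and is not: a LINEAR, frozen-coefficient (von Neumann) criterion for the advective part of the symbol only —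
the standard a-priori guide for choosing `cfl` in Fourier pseudo-spectral codes [cite: CanutoEtAl2006, App. D §D.2.5];
it is neither a nonlinear stability theorem for the Galerkin system nor an accuracy statement, and the viscous part
(negative real axis: treated exactly by an integrating factor in dns-B / the opt kernels, explicitly with its own step
limit in p1spec) is not covered here. 0 sorry; no named facts.
-/

noncomputable section

namespace Literature.Analysis.FluidPDE.FluidComputer

namespace RungeKutta

open Complex

/-! ### The two steppers on an autonomous right-hand side `f : ℂ → ℂ` -/

/-- One step of the classical four-stage fourth-order Runge–Kutta method for `u' = f(u)`:
`k₁ = f(u)`, `k₂ = f(u + Δt k₁/2)`, `k₃ = f(u + Δt k₂/2)`, `k₄ = f(u + Δt k₃)`,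
`u⁺ = u + Δt (k₁ + 2k₂ + 2k₃ + k₄)/6`. [cite: CanutoEtAl2006, App. D §D.2.5 (D.2.17)] -/
def rk4Step (f : ℂ → ℂ) (u dt : ℂ) : ℂ :=
  let k₁ := f u
  let k₂ := f (u + dt * k₁ / 2)
  let k₃ := f (u + dt * k₂ / 2)
  let k₄ := f (u + dt * k₃)
  u + dt * (k₁ + 2 * k₂ + 2 * k₃ + k₄) / 6

/-- One step of the Shu–Osher strong-stability-preserving third-order Runge–Kutta method for `u' = f(u)`:
`u₁ = u + Δt f(u)`, `u₂ = ¾u + ¼(u₁ + Δt f(u₁))`, `u⁺ = ⅓u + ⅔(u₂ + Δt f(u₂))` — the 'TVD' third-order scheme of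
Shu–Osher, `SSPRK(3,3)` in the SSP literature. [cite: GottliebKetchesonShu2011, §2.4.2 Thm. 2.3 (SSPRK(3,3))] -/
def ssprk3Step (f : ℂ → ℂ) (u dt : ℂ) : ℂ :=
  let u₁ := u + dt * f u
  let u₂ := 3 / 4 * u + 1 / 4 * (u₁ + dt * f u₁)
  1 / 3 * u + 2 / 3 * (u₂ + dt * f u₂)

/-- The stability polynomial of every four-stage fourth-order explicit Runge–Kutta method,
`R₄(z) = 1 + z + z²/2 + z³/6 + z⁴/24`. [cite: CanutoEtAl2006, App. D §D.2.5] -/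
def R4 (z : ℂ) : ℂ := 1 + z + z ^ 2 / 2 + z ^ 3 / 6 + z ^ 4 / 24

/-- The stability polynomial of every three-stage third-order explicit Runge–Kutta method,
`R₃(z) = 1 + z + z²/2 + z³/6`. [cite: CanutoEtAl2006, App. D §D.2.5] -/
def R3 (z : ℂ) : ℂ := 1 + z + z ^ 2 / 2 + z ^ 3 / 6

/-- On the scalar test equation `u' = λu` one classical RK4 step is multiplication by `R₄(λΔt)`.
[cite: CanutoEtAl2006, App. D §D.2.5] -/
theorem rk4Step_linear (lam u dt : ℂ) : rk4Step (fun v => lam * v) u dt = R4 (lam * dt) * u := by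
  simp only [rk4Step, R4]
  ring

/-- On the scalar test equation `u' = λu` one Shu–Osher SSP-RK3 step is multiplication by `R₃(λΔt)` — the same
stability polynomial as every three-stage third-order method ('any three-stage third order method can be written in
the Shu–Osher form', proof of Thm. 2.3). [cite: GottliebKetchesonShu2011, §2.4.2 Thm. 2.3] -/
theorem ssprk3Step_linear (lam u dt : ℂ) : ssprk3Step (fun v => lam * v) u dt = R3 (lam * dt) * u := by
  simp only [ssprk3Step, R3]
  ring

/-! ### The imaginary axis -/

/-- `R₄` at a purely imaginary argument: real part `1 − y²/2 + y⁴/24`, imaginary part `y − y³/6` (the computation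
behind Table D.1's RK4 entry). [cite: CanutoEtAl2006, App. D Table D.1] -/
theorem R4_imag (y : ℝ) : R4 ((y : ℂ) * I) = ⟨1 - y ^ 2 / 2 + y ^ 4 / 24, y - y ^ 3 / 6⟩ := by
  apply Complex.ext <;> simp [R4, pow_succ, Complex.mul_re, Complex.mul_im, Complex.add_re, Complex.add_im] <;> ring

/-- `R₃` at a purely imaginary argument: real part `1 − y²/2`, imaginary part `y − y³/6` (the computation behind
Table D.1's RK3 entry). [cite: CanutoEtAl2006, App. D Table D.1] -/
theorem R3_imag (y : ℝ) : R3 ((y : ℂ) * I) = ⟨1 - y ^ 2 / 2, y - y ^ 3 / 6⟩ := by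
  apply Complex.ext <;> simp [R3, pow_succ, Complex.mul_re, Complex.mul_im, Complex.add_re, Complex.add_im] <;> ring

/-- `|R₄(iy)|² = 1 − y⁶/72 + y⁸/576`. [cite: CanutoEtAl2006, App. D Table D.1] -/
theorem normSq_R4_imag (y : ℝ) : Complex.normSq (R4 ((y : ℂ) * I)) = 1 - y ^ 6 / 72 + y ^ 8 / 576 := by
  rw [R4_imag, Complex.normSq_mk]
  ring

/-- `|R₃(iy)|² = 1 − y⁴/12 + y⁶/36`. [cite: CanutoEtAl2006, App. D Table D.1] -/
theorem normSq_R3_imag (y : ℝ) : Complex.normSq (R3 ((y : ℂ) * I)) = 1 - y ^ 4 / 12 + y ^ 6 / 36 := by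
  rw [R3_imag, Complex.normSq_mk]
  ring

/-- RK4's IMAGINARY-AXIS STABILITY INTERVAL: `|R₄(iy)| ≤ 1 ⟺ y² ≤ 8`, i.e. `|y| ≤ 2√2 ≈ 2.83`.
[cite: CanutoEtAl2006, App. D Table D.1 (RK4: [0, 2.83])] -/
theorem norm_R4_imag_le_one_iff (y : ℝ) : ‖R4 ((y : ℂ) * I)‖ ≤ 1 ↔ y ^ 2 ≤ 8 := by
  have key : ‖R4 ((y : ℂ) * I)‖ ≤ 1 ↔ Complex.normSq (R4 ((y : ℂ) * I)) ≤ 1 := by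
    rw [Complex.normSq_eq_norm_sq]
    constructor
    · intro h; nlinarith [norm_nonneg (R4 ((y : ℂ) * I))]
    · intro h; nlinarith [norm_nonneg (R4 ((y : ℂ) * I))]
  rw [key, normSq_R4_imag]
  have h6 : 0 ≤ y ^ 6 := by positivity
  constructor
  · intro h
    -- y⁸/576 ≤ y⁶/72, i.e. y⁶ (y² − 8) ≤ 0
    by_contra hy
    have hy' : 8 < y ^ 2 := not_le.mp hy
    have hpos : 0 < y ^ 2 := by linarith
    have h6pos : 0 < y ^ 6 := by
      have h := pow_pos hpos 3
      calc (0 : ℝ) < (y ^ 2) ^ 3 := h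
        _ = y ^ 6 := by ring
    have : y ^ 6 * 8 < y ^ 6 * y ^ 2 := by nlinarith
    nlinarith
  · intro h
    have : y ^ 8 = y ^ 6 * y ^ 2 := by ring
    nlinarith

/-- RK3's IMAGINARY-AXIS STABILITY INTERVAL: `|R₃(iy)| ≤ 1 ⟺ y² ≤ 3`, i.e. `|y| ≤ √3 ≈ 1.73`.
[cite: CanutoEtAl2006, App. D Table D.1 (RK3: [0, 1.73])] -/
theorem norm_R3_imag_le_one_iff (y : ℝ) : ‖R3 ((y : ℂ) * I)‖ ≤ 1 ↔ y ^ 2 ≤ 3 := by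
  have key : ‖R3 ((y : ℂ) * I)‖ ≤ 1 ↔ Complex.normSq (R3 ((y : ℂ) * I)) ≤ 1 := by
    rw [Complex.normSq_eq_norm_sq]
    constructor
    · intro h; nlinarith [norm_nonneg (R3 ((y : ℂ) * I))]
    · intro h; nlinarith [norm_nonneg (R3 ((y : ℂ) * I))]
  rw [key, normSq_R3_imag]
  constructor
  · intro h
    by_contra hy
    have hy' : 3 < y ^ 2 := not_le.mp hy
    have hpos : 0 < y ^ 2 := by linarith
    have h4pos : 0 < y ^ 4 := by
      have h := pow_pos hpos 2
      calc (0 : ℝ) < (y ^ 2) ^ 2 := h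
        _ = y ^ 4 := by ring
    have : y ^ 4 * 3 < y ^ 4 * y ^ 2 := by nlinarith
    nlinarith
  · intro h
    have h4 : 0 ≤ y ^ 4 := by positivity
    have : y ^ 6 = y ^ 4 * y ^ 2 := by ring
    nlinarith

/-! ### The advective CFL reading on the cubic 2/3 truncation -/

/-- The frozen-coefficient advective symbol is bounded by the ℓ¹ velocity times the largest retained wavenumber
component: `|U·k| ≤ (|U₁|+|U₂|+|U₃|) · K` when `|k_i| ≤ K` — the three-dimensional form of the spatial eigenvalue bound
`|λ| ≤ N/2` of the Fourier advection problem behind the stability limit (D.2.6). [cite: CanutoEtAl2006, App. D (D.2.6)] -/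
theorem advective_symbol_le {U₁ U₂ U₃ k₁ k₂ k₃ K : ℝ} (h₁ : |k₁| ≤ K) (h₂ : |k₂| ≤ K) (h₃ : |k₃| ≤ K) :
    |U₁ * k₁ + U₂ * k₂ + U₃ * k₃| ≤ (|U₁| + |U₂| + |U₃|) * K := by
  have hK : 0 ≤ K := (abs_nonneg _).trans h₁
  calc |U₁ * k₁ + U₂ * k₂ + U₃ * k₃| ≤ |U₁ * k₁| + |U₂ * k₂| + |U₃ * k₃| := abs_add_three _ _ _
    _ = |U₁| * |k₁| + |U₂| * |k₂| + |U₃| * |k₃| := by rw [abs_mul, abs_mul, abs_mul]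
    _ ≤ |U₁| * K + |U₂| * K + |U₃| * K := by
        gcongr
    _ = (|U₁| + |U₂| + |U₃|) * K := by ring

/-- THE STEP RULE IN SYMBOL UNITS: with `Δt ≤ cfl · h / S`, `S = |U₁|+|U₂|+|U₃| > 0`, and retained wavenumbers
`|k_i| · h ≤ κ` (cubic 2/3 truncation: `κ = 2π/3` for every `N` since `|j_i| < N/3`, `k_i = 2π j_i/L`, `h = L/N`; the
lattice's own value is `κ = 2π j_max/N`, e.g. `2π · 85/256`), the advective symbol satisfies `|U·k| · Δt ≤ cfl · κ` —
so 'temporal stability limit `(N/2)Δt ≤ c`, i.e. `Δt ≤ (c/π)Δx`' (D.2.6, unit speed, full modes) becomes `cfl · κ ≤ c`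
here. [cite: CanutoEtAl2006, App. D (D.2.6)] -/
theorem symbol_dt_le {U₁ U₂ U₃ k₁ k₂ k₃ h dt cfl κ : ℝ} (hh : 0 < h)
    (hS : 0 < |U₁| + |U₂| + |U₃|)
    (hk₁ : |k₁| * h ≤ κ) (hk₂ : |k₂| * h ≤ κ) (hk₃ : |k₃| * h ≤ κ)
    (hdt0 : 0 ≤ dt) (hdt : dt ≤ cfl * h / (|U₁| + |U₂| + |U₃|)) :
    |U₁ * k₁ + U₂ * k₂ + U₃ * k₃| * dt ≤ cfl * κ := by
  set S := |U₁| + |U₂| + |U₃| with hS_def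
  have hκ : 0 ≤ κ := le_trans (by positivity) hk₁
  have hK : ∀ {k : ℝ}, |k| * h ≤ κ → |k| ≤ κ / h := fun hk => by
    rw [le_div_iff₀ hh]; exact hk
  have hsym := advective_symbol_le (U₁ := U₁) (U₂ := U₂) (U₃ := U₃) (hK hk₁) (hK hk₂) (hK hk₃)
  calc |U₁ * k₁ + U₂ * k₂ + U₃ * k₃| * dt ≤ S * (κ / h) * (cfl * h / S) :=
        mul_le_mul hsym hdt hdt0 (by positivity)
    _ = cfl * κ := by field_simp

/-- RK4 WINDOW: `cfl ≤ 1.35 ⟹ (cfl · 2π/3)² ≤ 8`, so the whole advective spectrum under the step rule sits in RK4's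
imaginary-axis stability interval (`norm_R4_imag_le_one_iff`); the exact threshold is `3√2/π = 1.3505`; the cell's
production `cfl ≤ 0.75` is a factor `1.8` inside. [cite: CanutoEtAl2006, App. D Table D.1] -/
theorem rk4_cfl_window {cfl : ℝ} (h0 : 0 ≤ cfl) (h : cfl ≤ 1.35) : (cfl * (2 * Real.pi / 3)) ^ 2 ≤ 8 := by
  have hpi := Real.pi_lt_d4  -- π < 3.1416
  have hx : cfl * (2 * Real.pi / 3) ≤ 1.35 * (2 * 3.1416 / 3) := by
    apply mul_le_mul h _ (by positivity) (by norm_num)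
    linarith
  have hx0 : 0 ≤ cfl * (2 * Real.pi / 3) := by positivity
  nlinarith

/-- RK3 WINDOW: `cfl ≤ 0.826 ⟹ (cfl · 2π/3)² ≤ 3`, so the advective spectrum sits in RK3's interval
(`norm_R3_imag_le_one_iff`); the exact threshold is `3√3/(2π) = 0.82699…` (so `0.827` is already outside by `10⁻⁵`);
dns-B's production `cfl = 0.75` is inside by a factor `1.10`. [cite: CanutoEtAl2006, App. D Table D.1] -/
theorem rk3_cfl_window {cfl : ℝ} (h0 : 0 ≤ cfl) (h : cfl ≤ 0.826) : (cfl * (2 * Real.pi / 3)) ^ 2 ≤ 3 := by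
  have hpi := Real.pi_lt_d4
  have hx : cfl * (2 * Real.pi / 3) ≤ 0.826 * (2 * 3.1416 / 3) := by
    apply mul_le_mul h _ (by positivity) (by norm_num)
    linarith
  have hx0 : 0 ≤ cfl * (2 * Real.pi / 3) := by positivity
  nlinarith

/-- THE LATTICE'S OWN BOUND at `N = 256` (`k_max = 85`, so `|k_i| · h ≤ 2π · 85/256 = 2.0862`; the same ratio at
`N = 512`, `k_max = 170`): the RK3 window is `cfl ≤ 0.83` — `(0.83 · 2π · 85/256)² ≤ 3` (exact threshold `0.8302`), which is
§B.2's printed value; the `N`-free `κ = 2π/3` gives the slightly conservative `0.827`. [cite: CanutoEtAl2006, App. D Table D.1] -/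
theorem rk3_cfl_window_kmax85 {cfl : ℝ} (h0 : 0 ≤ cfl) (h : cfl ≤ 0.83) :
    (cfl * (2 * Real.pi * 85 / 256)) ^ 2 ≤ 3 := by
  have hpi := Real.pi_lt_d4
  have hx : cfl * (2 * Real.pi * 85 / 256) ≤ 0.83 * (2 * 3.1416 * 85 / 256) := by
    apply mul_le_mul h _ (by positivity) (by norm_num)
    nlinarith
  have hx0 : 0 ≤ cfl * (2 * Real.pi * 85 / 256) := by positivity
  nlinarith

/-- THE PRODUCTION VALUE: at `cfl = 0.75` the advective spectrum reaches at most `y = 0.75 · 2π/3 = π/2 ≈ 1.571` on the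
imaginary axis, inside BOTH windows (`y² ≤ 2.47 < 3 < 8`), so `|R₃(iy)| ≤ 1` and `|R₄(iy)| ≤ 1` for every retained mode.
[cite: CanutoEtAl2006, App. D Table D.1] -/
theorem production_cfl_inside (y : ℝ) (hy : |y| ≤ 0.75 * (2 * Real.pi / 3)) :
    ‖R3 ((y : ℂ) * I)‖ ≤ 1 ∧ ‖R4 ((y : ℂ) * I)‖ ≤ 1 := by
  have hpi := Real.pi_lt_d4
  have hb : 0.75 * (2 * Real.pi / 3) ≤ (1.571 : ℝ) := by nlinarith
  have hy' : |y| ≤ 1.571 := hy.trans hb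
  have hy2 : y ^ 2 ≤ 1.571 ^ 2 := by
    rw [← sq_abs]; exact pow_le_pow_left₀ (abs_nonneg y) hy' 2
  refine ⟨(norm_R3_imag_le_one_iff y).mpr (by nlinarith), (norm_R4_imag_le_one_iff y).mpr (by nlinarith)⟩

/-! ### Accuracy on the test equation (appended, p1 gen 9): the stability polynomials are Taylor polynomials of `exp`

[cite: HairerNorsettWanner1993, §II.1 Def. 1.2]: a method has ORDER `p` if one step from exact data errs by `≤ K h^{p+1}`.
On the scalar test equation `u' = λu` the exact step is multiplication by `e^{z}`, `z = λΔt`, and the RK4 / SSP-RK3 steps are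
multiplication by `R₄(z)` / `R₃(z)` (`rk4Step_linear`, `ssprk3Step_linear`), the Taylor polynomials of `exp` of degree 4 / 3;
Mathlib's remainder bound `Complex.exp_bound'` then gives the one-step (local) errors `|z|⁵/60` (`|z| ≤ 3`) and `|z|⁴/12`
(`|z| ≤ 5/2`) — order 4 resp. 3 on this equation, with explicit constants — and, for a retained ADVECTIVE mode (`z = iy` inside
the stability interval, where `|R(iy)| ≤ 1 = |e^{iy}|`), the `n`-step (global) amplitude-and-phase error `≤ n|y|⁵/60` resp.
`≤ n|y|⁴/12`: `O(T Δt⁴)` / `O(T Δt³)` at fixed `T = nΔt` for a fixed mode. Honest reading: informative for well-resolved modes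
(`y = 0.3`: `4·10⁻⁵` per RK4 step); for the last retained shell at production `cfl = 0.75` (`y` up to `π/2`) the per-step bound is
`0.16` — stability, not accuracy, is what the CFL window buys there (the general nonlinear order statement is HNW Thm. 2.13 with
the tableau identities of `Literature.Analysis.ODE.RungeKuttaOrderConditions`; the global transport is `OneStepGlobalError`). -/

/-- `R₄` is the degree-4 Taylor polynomial of `exp`: `R₄(z) = Σ_{m<5} z^m/m!`. [cite: CanutoEtAl2006, App. D §D.2.5] -/
theorem R4_eq_taylor (z : ℂ) : R4 z = ∑ m ∈ Finset.range 5, z ^ m / (m.factorial : ℂ) := by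
  simp only [R4, Finset.sum_range_succ, Finset.sum_range_zero, Nat.factorial]
  push_cast
  ring

/-- `R₃` is the degree-3 Taylor polynomial of `exp`: `R₃(z) = Σ_{m<4} z^m/m!`. [cite: CanutoEtAl2006, App. D §D.2.5] -/
theorem R3_eq_taylor (z : ℂ) : R3 z = ∑ m ∈ Finset.range 4, z ^ m / (m.factorial : ℂ) := by
  simp only [R3, Finset.sum_range_succ, Finset.sum_range_zero, Nat.factorial]
  push_cast
  ring

/-- LOCAL ERROR OF RK4 ON THE TEST EQUATION: `|e^{z} − R₄(z)| ≤ |z|⁵/60` for `|z| ≤ 3` (Taylor remainder; the sharper `|z|⁵/100`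
holds for `|z| ≤ 1`). [cite: HairerNorsettWanner1993, §II.1 Def. 1.2] -/
theorem norm_exp_sub_R4_le (z : ℂ) (hz : ‖z‖ ≤ 3) : ‖Complex.exp z - R4 z‖ ≤ ‖z‖ ^ 5 / 60 := by
  have hx : ‖z‖ / (Nat.succ 5 : ℕ) ≤ 1 / 2 := by
    rw [div_le_iff₀ (by positivity)]; push_cast; linarith
  have h := Complex.exp_bound' (x := z) (n := 5) hx
  rw [← R4_eq_taylor] at h
  calc ‖Complex.exp z - R4 z‖ ≤ ‖z‖ ^ 5 / (Nat.factorial 5 : ℕ) * 2 := h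
    _ = ‖z‖ ^ 5 / 60 := by simp [Nat.factorial]; ring

/-- LOCAL ERROR OF SSP-RK3 ON THE TEST EQUATION: `|e^{z} − R₃(z)| ≤ |z|⁴/12` for `|z| ≤ 5/2`.
[cite: HairerNorsettWanner1993, §II.1 Def. 1.2] -/
theorem norm_exp_sub_R3_le (z : ℂ) (hz : ‖z‖ ≤ 5 / 2) : ‖Complex.exp z - R3 z‖ ≤ ‖z‖ ^ 4 / 12 := by
  have hx : ‖z‖ / (Nat.succ 4 : ℕ) ≤ 1 / 2 := by
    rw [div_le_iff₀ (by positivity)]; push_cast; linarith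
  have h := Complex.exp_bound' (x := z) (n := 4) hx
  rw [← R3_eq_taylor] at h
  calc ‖Complex.exp z - R3 z‖ ≤ ‖z‖ ^ 4 / (Nat.factorial 4 : ℕ) * 2 := h
    _ = ‖z‖ ^ 4 / 12 := by simp [Nat.factorial]; ring

/-- One classical RK4 step from exact data `u` on `u' = λu` (exact value `e^{λΔt} u`) errs by at most `|λΔt|⁵/60 · |u|`
(`|λΔt| ≤ 3`): order 4 in the sense of Def. 1.2 on this equation, constant explicit. [cite: HairerNorsettWanner1993, §II.1 Def. 1.2] -/
theorem rk4Step_local_error (lam u dt : ℂ) (h : ‖lam * dt‖ ≤ 3) :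
    ‖Complex.exp (lam * dt) * u - rk4Step (fun v => lam * v) u dt‖ ≤ ‖lam * dt‖ ^ 5 / 60 * ‖u‖ := by
  rw [rk4Step_linear, ← sub_mul, norm_mul]
  exact mul_le_mul_of_nonneg_right (norm_exp_sub_R4_le _ h) (norm_nonneg _)

/-- One Shu–Osher SSP-RK3 step from exact data `u` on `u' = λu` errs by at most `|λΔt|⁴/12 · |u|` (`|λΔt| ≤ 5/2`): order 3 on
this equation. [cite: HairerNorsettWanner1993, §II.1 Def. 1.2] -/
theorem ssprk3Step_local_error (lam u dt : ℂ) (h : ‖lam * dt‖ ≤ 5 / 2) :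
    ‖Complex.exp (lam * dt) * u - ssprk3Step (fun v => lam * v) u dt‖ ≤ ‖lam * dt‖ ^ 4 / 12 * ‖u‖ := by
  rw [ssprk3Step_linear, ← sub_mul, norm_mul]
  exact mul_le_mul_of_nonneg_right (norm_exp_sub_R3_le _ h) (norm_nonneg _)

/-- GLOBAL ERROR OF RK4 FOR ONE RETAINED ADVECTIVE MODE: if `y = |U·k| Δt` lies in the stability interval (`y² ≤ 8`, e.g. under
`rk4_cfl_window`), then after `n` steps `|R₄(iy)ⁿ − e^{iny}| ≤ n · |y|⁵/60` — `O(T Δt⁴)` at fixed `T = nΔt` and fixed mode (both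
multipliers have modulus `≤ 1`, so local errors add without amplification: `‖aⁿ − bⁿ‖ ≤ n‖a − b‖`, the tree's
`Literature.NumberTheory.LFunctions.Konieczny.norm_pow_sub_pow_le`). [cite: HairerNorsettWanner1993, §II.3 Thm. 3.4] -/
theorem rk4_advective_global_error (y : ℝ) (hy : y ^ 2 ≤ 8) (n : ℕ) :
    ‖R4 ((y : ℂ) * I) ^ n - Complex.exp ((y : ℂ) * I) ^ n‖ ≤ n * (|y| ^ 5 / 60) := by
  have hz : ‖(y : ℂ) * I‖ = |y| := by simp
  have hy3 : |y| ≤ 3 := by nlinarith [abs_nonneg y, sq_abs y]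
  have hR : ‖R4 ((y : ℂ) * I)‖ ≤ 1 := (norm_R4_imag_le_one_iff y).mpr hy
  have hE : ‖Complex.exp ((y : ℂ) * I)‖ ≤ 1 := by rw [Complex.norm_exp_ofReal_mul_I]
  have hloc : ‖R4 ((y : ℂ) * I) - Complex.exp ((y : ℂ) * I)‖ ≤ |y| ^ 5 / 60 := by
    rw [norm_sub_rev, ← hz]; exact norm_exp_sub_R4_le _ (by rw [hz]; exact hy3)
  calc ‖R4 ((y : ℂ) * I) ^ n - Complex.exp ((y : ℂ) * I) ^ n‖ ≤ n * ‖R4 ((y : ℂ) * I) - Complex.exp ((y : ℂ) * I)‖ :=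
        Literature.NumberTheory.LFunctions.Konieczny.norm_pow_sub_pow_le hR hE n
    _ ≤ n * (|y| ^ 5 / 60) := by gcongr

/-- GLOBAL ERROR OF SSP-RK3 FOR ONE RETAINED ADVECTIVE MODE: `y² ≤ 3` (the RK3 interval, e.g. under `rk3_cfl_window`) ⇒ after
`n` steps `|R₃(iy)ⁿ − e^{iny}| ≤ n · |y|⁴/12` (`O(T Δt³)`). [cite: HairerNorsettWanner1993, §II.3 Thm. 3.4] -/
theorem rk3_advective_global_error (y : ℝ) (hy : y ^ 2 ≤ 3) (n : ℕ) :
    ‖R3 ((y : ℂ) * I) ^ n - Complex.exp ((y : ℂ) * I) ^ n‖ ≤ n * (|y| ^ 4 / 12) := by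
  have hz : ‖(y : ℂ) * I‖ = |y| := by simp
  have hy2 : |y| ≤ 5 / 2 := by nlinarith [abs_nonneg y, sq_abs y]
  have hR : ‖R3 ((y : ℂ) * I)‖ ≤ 1 := (norm_R3_imag_le_one_iff y).mpr hy
  have hE : ‖Complex.exp ((y : ℂ) * I)‖ ≤ 1 := by rw [Complex.norm_exp_ofReal_mul_I]
  have hloc : ‖R3 ((y : ℂ) * I) - Complex.exp ((y : ℂ) * I)‖ ≤ |y| ^ 4 / 12 := by
    rw [norm_sub_rev, ← hz]; exact norm_exp_sub_R3_le _ (by rw [hz]; exact hy2)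
  calc ‖R3 ((y : ℂ) * I) ^ n - Complex.exp ((y : ℂ) * I) ^ n‖ ≤ n * ‖R3 ((y : ℂ) * I) - Complex.exp ((y : ℂ) * I)‖ :=
        Literature.NumberTheory.LFunctions.Konieczny.norm_pow_sub_pow_le hR hE n
    _ ≤ n * (|y| ^ 4 / 12) := by gcongr

/-- The production numbers: per RK4 step a mode at `y = 0.3` (well resolved) errs by `≤ 0.3⁵/60 < 4.1·10⁻⁵`, while the last
retained shell at `cfl = 0.75` (`y ≤ π/2 < 1.5708`) is only guaranteed `≤ 1.5708⁵/60 < 0.16` — the CFL window buys stability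
there, not accuracy. [cite: CanutoEtAl2006, App. D §D.2.5] -/
theorem production_local_error_numbers :
    (0.3 : ℝ) ^ 5 / 60 < 4.1e-5 ∧ (1.5708 : ℝ) ^ 5 / 60 < 0.16 ∧ Real.pi / 2 < 1.5708 := by
  refine ⟨by norm_num, by norm_num, ?_⟩
  have := Real.pi_lt_d4
  linarith

/-! ### Numerical dissipation of a pure oscillation mode (appended, p1 gen 9)

Inside the OPEN stability intervals the two explicit steppers strictly DAMP a pure oscillation `u' = iωu` (the frozen advective mode,
or a Galerkin-truncated EULER mode): the quadratic invariant `|u|²` is multiplied per step by `|R(iy)|² < 1`. This is the concrete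
form, on the test equation, of the fact that no explicit Runge–Kutta method conserves quadratic invariants
(`Literature.Analysis.ODE.RungeKuttaInvariants`, Hairer–Lubich–Wanner GNI §IV.2 Thm. 2.2): the energy drift of a `ν = 0` control
leg is a time-stepping effect even though the truncated Euler ODE conserves energy exactly (`DetailedLiouville`). -/

/-- RK4: `1 − |R₄(iy)|² = y⁶(8 − y²)/576` — per-step relative energy loss of a mode, leading order `y⁶/72`.
[cite: CanutoEtAl2006, App. D Table D.1] -/
theorem one_sub_normSq_R4_imag (y : ℝ) : 1 - Complex.normSq (R4 ((y : ℂ) * I)) = y ^ 6 * (8 - y ^ 2) / 576 := by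
  rw [normSq_R4_imag]; ring

/-- SSP-RK3: `1 − |R₃(iy)|² = y⁴(3 − y²)/36` — leading order `y⁴/12`. [cite: CanutoEtAl2006, App. D Table D.1] -/
theorem one_sub_normSq_R3_imag (y : ℝ) : 1 - Complex.normSq (R3 ((y : ℂ) * I)) = y ^ 4 * (3 - y ^ 2) / 36 := by
  rw [normSq_R3_imag]; ring

/-- STRICT DAMPING inside the open intervals: `0 < y² < 8 ⇒ |R₄(iy)|² < 1` and `0 < y² < 3 ⇒ |R₃(iy)|² < 1` (equality only at `y = 0`
and at the interval ends). [cite: CanutoEtAl2006, App. D Table D.1] -/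
theorem normSq_imag_lt_one {y : ℝ} (hy0 : y ≠ 0) :
    (y ^ 2 < 8 → Complex.normSq (R4 ((y : ℂ) * I)) < 1) ∧ (y ^ 2 < 3 → Complex.normSq (R3 ((y : ℂ) * I)) < 1) := by
  have h4 : 0 < y ^ 4 := by positivity
  have h6 : 0 < y ^ 6 := by positivity
  refine ⟨fun hy => ?_, fun hy => ?_⟩
  · have : 0 < y ^ 6 * (8 - y ^ 2) / 576 := div_pos (mul_pos h6 (by linarith)) (by norm_num)
    linarith [one_sub_normSq_R4_imag y]
  · have : 0 < y ^ 4 * (3 - y ^ 2) / 36 := div_pos (mul_pos h4 (by linarith)) (by norm_num)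
    linarith [one_sub_normSq_R3_imag y]

/-- Over `n` steps a mode keeps at least the Bernoulli fraction of its energy: `|R₄(iy)|^{2n} ≥ 1 − n·y⁶(8 − y²)/576` (informative
inside the interval `y² ≤ 8`; true for every `y` by Bernoulli's inequality). [cite: HairerNorsettWanner1993, §II.3 Thm. 3.4] -/
theorem normSq_R4_pow_ge (y : ℝ) (n : ℕ) :
    1 - n * (y ^ 6 * (8 - y ^ 2) / 576) ≤ Complex.normSq (R4 ((y : ℂ) * I)) ^ n := by
  have hd1 : y ^ 6 * (8 - y ^ 2) / 576 ≤ 1 := by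
    have := Complex.normSq_nonneg (R4 ((y : ℂ) * I))
    linarith [one_sub_normSq_R4_imag y]
  have hb := one_add_mul_le_pow (a := -(y ^ 6 * (8 - y ^ 2) / 576)) (by linarith) n
  have he : (1 : ℝ) + -(y ^ 6 * (8 - y ^ 2) / 576) = Complex.normSq (R4 ((y : ℂ) * I)) := by
    linarith [one_sub_normSq_R4_imag y]
  rw [he] at hb
  linarith

/-- The numbers: per step a mode at `y = 0.3` loses `< 1.01·10⁻⁵` of its energy under RK4 and `< 6.6·10⁻⁴` under SSP-RK3; at
`y = 0.05` the losses are `< 2.2·10⁻¹⁰` and `< 5.3·10⁻⁷` — a `ν = 0` leg's energy drift localises in its highest resolved shells and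
scales as `Δt⁵` (RK4) / `Δt³` (RK3) per unit time. [cite: CanutoEtAl2006, App. D Table D.1] -/
theorem dissipation_numbers :
    (0.3 : ℝ) ^ 6 * (8 - 0.3 ^ 2) / 576 < 1.01e-5 ∧ (0.3 : ℝ) ^ 4 * (3 - 0.3 ^ 2) / 36 < 6.6e-4 ∧
      (0.05 : ℝ) ^ 6 * (8 - 0.05 ^ 2) / 576 < 2.2e-10 ∧ (0.05 : ℝ) ^ 4 * (3 - 0.05 ^ 2) / 36 < 5.3e-7 := by
  norm_num

end RungeKutta

end Literature.Analysis.FluidPDE.FluidComputer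

end
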